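import Literature.NumberTheory.EllipticCurves.HeckeOperators
import Mathlib.RingTheory.RootsOfUnity.Complex
import HarnessLib

/-!
# Discharges of named facts in `HeckeOperators.lean` (trunk EllArithM, item C5)

D-0014 keeps `Literature/` sorry-free by stating cited results as named facts `def X : Prop`.
This sibling file proves three facts of `Literature.NumberTheory.EllipticCurves.HeckeOperators`
as `theorem X_holds : X`; users holding `(h : X)` are fed `X_holds`.

* `heckeCorrespondence_apply_eq_sum_slash_holds`, `heckeOperator_apply_eq_sum_slash_holds`: the
  **double coset formula** `[Γ g Γ'] f = ∑ᵢ f ∣[k] αᵢ` whenever `Γ g Γ' = ⊔ᵢ Γ αᵢ`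
  (Diamond–Shurman Lemma 5.1.2 and Def. 5.1.3; Shimura 1971, Prop. 3.1, (3.4.4)). Mathlib's
  `ModularForm.trace` is a sum over `Γ' ⧸ Γ₃`, `Γ₃ = g⁻¹ Γ g ⊓ Γ'`; Lemma 5.1.2 is the bijection
  `orbitIndexQuot : Γ' ⧸ Γ₃ ≃ ι` (`orbitIndexQuot_bijective`).
* `coe_heckeT_gamma0_eq_sum` (**Diamond–Shurman Prop. 5.2.1** for `Γ₀(N)`, `p` prime):
  `T_p f = ∑_{j mod p} f ∣[k] (1 j; 0 p) + 𝟙_{p ∤ N} f ∣[k] diag(p, 1)`, from the double coset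
  formula and the coset computation `Γ₃ = Γ₀(N) ∩ Γ⁰(p)` (`exists_mul_tpG_eq_iff`,
  `existsUnique_fin`, `existsUnique_option`, `tpD_mem_doubleCoset`).
* `qExpansion_coeff_heckeT_holds` (**Diamond–Shurman Prop. 5.2.2(a)**, trivial character):
  `a_n(T_p f) = a_{pn}(f) + 𝟙_N(p) p^{k-1} a_{n/p}(f)` for `f ∈ S_k(Γ₀(N))`, by the Fourier
  computation of the source (`hasSum_sum_slash_tpB`: orthogonality of `j ↦ ζ_p^{mj}`;
  `hasSum_slash_tpD`) and uniqueness of `q`-expansion coefficients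
  (`ModularFormClass.qExpansion_coeff_unique`).

Notation used throughout: `tpG p = diag(1, p)`, `tpD p = diag(p, 1)`, `tpB p j = diag(1, p) Tʲ =
(1 j; 0 p)` in `GL(2, ℝ)`; `ζp p = e^{2πi/p}`.

## References

* F. Diamond, J. Shurman, *A first course in modular forms*, GTM 228, Springer 2005, §5.1–5.2
  (Lemma 5.1.2, Def. 5.1.3, (5.2), Prop. 5.2.1, Prop. 5.2.2), doi:10.1007/978-0-387-27226-9.
* G. Shimura, *Introduction to the arithmetic theory of automorphic functions*, 1971, §3.4.
-/

noncomputable section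

open scoped MatrixGroups ModularForm Real

open ConjAct Pointwise Complex
open UpperHalfPlane hiding I

namespace Literature.NumberTheory.EllipticCurves.ModularForms

/-! ### The double coset formula (Diamond–Shurman Lemma 5.1.2, Def. 5.1.3; Shimura (3.4.4)) -/

section DoubleCoset

variable {Γ Γ' : Subgroup (GL (Fin 2) ℝ)} {G : GL (Fin 2) ℝ} {ι : Type*} (α : ι → GL (Fin 2) ℝ)

/-- Membership in the conjugated level `G⁻¹ Γ G` of `ModularForm.translate f G`. [folklore] -/
lemma mem_conjLevel_iff (x : GL (Fin 2) ℝ) :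
    x ∈ toConjAct G⁻¹ • Γ ↔ G * x * G⁻¹ ∈ Γ := by
  rw [toConjAct_inv, Subgroup.mem_inv_pointwise_smul_iff, toConjAct_smul]

variable (Γ) in
/-- For `r ∈ Γ'`, `G r⁻¹` lies in the double coset `Γ G Γ'`. [folklore] -/
lemma mul_inv_mem_doubleCoset (r : Γ') :
    G * (r : GL (Fin 2) ℝ)⁻¹ ∈ DoubleCoset.doubleCoset G (Γ : Set (GL (Fin 2) ℝ)) Γ' :=
  DoubleCoset.mem_doubleCoset.mpr ⟨1, Γ.one_mem, (r : GL (Fin 2) ℝ)⁻¹, inv_mem r.2, by simp⟩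

variable (hα' : ∀ x ∈ DoubleCoset.doubleCoset G (Γ : Set (GL (Fin 2) ℝ)) Γ', ∃! i, x * (α i)⁻¹ ∈ Γ)

/-- The index of the `Γ`-orbit `Γ αᵢ ∋ G r⁻¹`, for `r ∈ Γ'` (Diamond–Shurman Lemma 5.1.2). [cite: DiamondShurman2005, Lemma 5.1.2] -/
def orbitIndex (r : Γ') : ι :=
  (hα' _ (mul_inv_mem_doubleCoset Γ r)).choose

/-- Defining property of `orbitIndex`: `G r⁻¹ ∈ Γ α_{orbitIndex r}`. [folklore] -/
lemma orbitIndex_spec (r : Γ') :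
    G * (r : GL (Fin 2) ℝ)⁻¹ * (α (orbitIndex α hα' r))⁻¹ ∈ Γ :=
  (hα' _ (mul_inv_mem_doubleCoset Γ r)).choose_spec.1

/-- Uniqueness of `orbitIndex`: the `Γ`-orbits `Γ αᵢ` are disjoint. [folklore] -/
lemma orbitIndex_unique {r : Γ'} {i : ι} (hi : G * (r : GL (Fin 2) ℝ)⁻¹ * (α i)⁻¹ ∈ Γ) :
    i = orbitIndex α hα' r :=
  (hα' _ (mul_inv_mem_doubleCoset Γ r)).choose_spec.2 i hi

/-- `orbitIndex` is constant on left cosets of `Γ₃ = G⁻¹ Γ G ⊓ Γ'` in `Γ'` (Diamond–Shurman Lemma 5.1.2, well-definedness). [cite: DiamondShurman2005, Lemma 5.1.2] -/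
lemma orbitIndex_eq_of_rel {r r' : Γ'}
    (h : ((r : GL (Fin 2) ℝ)⁻¹ * r') ∈ toConjAct G⁻¹ • Γ) :
    orbitIndex α hα' r = orbitIndex α hα' r' := by
  refine orbitIndex_unique α hα' ?_
  rw [mem_conjLevel_iff] at h
  simpa [mul_assoc] using Γ.mul_mem (Γ.inv_mem h) (orbitIndex_spec α hα' r)

/-- Conversely, `r, r' ∈ Γ'` with the same `orbitIndex` lie in the same left coset of `Γ₃` (Diamond–Shurman Lemma 5.1.2, injectivity). [cite: DiamondShurman2005, Lemma 5.1.2] -/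
lemma rel_of_orbitIndex_eq {r r' : Γ'} (h : orbitIndex α hα' r = orbitIndex α hα' r') :
    ((r : GL (Fin 2) ℝ)⁻¹ * r') ∈ toConjAct G⁻¹ • Γ := by
  rw [mem_conjLevel_iff]
  have h1 := orbitIndex_spec α hα' r
  have h2 := orbitIndex_spec α hα' r'
  rw [h] at h1
  simpa [mul_assoc] using Γ.mul_mem h1 (Γ.inv_mem h2)

/-- The map `Γ' ⧸ Γ₃ → ι`, `r Γ₃ ↦ (i with G r⁻¹ ∈ Γ αᵢ)`, of Diamond–Shurman Lemma 5.1.2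
(`Γ₃ = G⁻¹ Γ G ⊓ Γ'`; left cosets `r Γ₃` correspond to the source's right cosets `Γ₃ r⁻¹`). [cite: DiamondShurman2005, Lemma 5.1.2] -/
def orbitIndexQuot : Γ' ⧸ (toConjAct G⁻¹ • Γ).subgroupOf Γ' → ι :=
  Quotient.lift (orbitIndex α hα') fun r r' h ↦
    orbitIndex_eq_of_rel α hα' (by
      rw [← Quotient.eq_iff_equiv, Quotient.eq, QuotientGroup.leftRel_apply,
        Subgroup.mem_subgroupOf] at h
      simpa using h)

/-- Unfolding lemma for `orbitIndexQuot`. [folklore] -/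
@[simp] lemma orbitIndexQuot_mk (r : Γ') :
    orbitIndexQuot α hα' ⟦r⟧ = orbitIndex α hα' r :=
  rfl

variable (hα : ∀ i, α i ∈ DoubleCoset.doubleCoset G (Γ : Set (GL (Fin 2) ℝ)) Γ')

include hα in
/-- The map `Γ' ⧸ Γ₃ → ι` of Diamond–Shurman Lemma 5.1.2 is a bijection onto the orbit space
`Γ \\ Γ G Γ' ≃ ι`. [cite: DiamondShurman2005, Lemma 5.1.2] -/
lemma orbitIndexQuot_bijective : Function.Bijective (orbitIndexQuot α hα') := by
  constructor
  · intro q q'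
    induction q using Quotient.inductionOn with
    | h r =>
      induction q' using Quotient.inductionOn with
      | h r' =>
        intro h
        simp only [orbitIndexQuot_mk] at h
        apply Quotient.sound
        change QuotientGroup.leftRel _ r r'
        rw [QuotientGroup.leftRel_apply, Subgroup.mem_subgroupOf]
        simpa using rel_of_orbitIndex_eq α hα' h
  · intro i
    obtain ⟨x, hx, y, hy, hxy⟩ := DoubleCoset.mem_doubleCoset.mp (hα i)
    refine ⟨⟦⟨y⁻¹, inv_mem hy⟩⟧, ?_⟩
    rw [orbitIndexQuot_mk]
    refine (orbitIndex_unique α hα' ?_).symm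
    simpa [hxy, mul_assoc] using Γ.inv_mem hx

end DoubleCoset

/-- Discharge of `heckeCorrespondence_apply_eq_sum_slash` (**double coset formula**,
Diamond–Shurman Lemma 5.1.2 with Def. 5.1.3; Shimura 1971, Prop. 3.1 and (3.4.4)): if
`Γ g Γ' = ⊔ᵢ Γ αᵢ` then `[Γ g Γ'] f = ∑ᵢ f ∣[k] αᵢ`. Proof: Mathlib's trace is
`∑_{r ∈ Γ'/Γ₃} (f ∣ g) ∣ r⁻¹` with `Γ₃ = g⁻¹Γg ⊓ Γ'`; the map `r Γ₃ ↦ (i with G r⁻¹ ∈ Γ αᵢ)` is a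
bijection `Γ'/Γ₃ ≃ ι` (Lemma 5.1.2) and `f ∣ (γ αᵢ) = f ∣ αᵢ` for `γ ∈ Γ`. [cite: DiamondShurman2005, Lemma 5.1.2 and Def. 5.1.3] -/
theorem heckeCorrespondence_apply_eq_sum_slash_holds : heckeCorrespondence_apply_eq_sum_slash := by
  intro Γ Γ' _ _ k g ι _ α hα hα' f
  letI := Fintype.ofFinite (Γ' ⧸ (toConjAct (glCast g)⁻¹ • Γ).subgroupOf Γ')
  have key : ∀ q : Γ' ⧸ (toConjAct (glCast g)⁻¹ • Γ).subgroupOf Γ',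
      SlashInvariantForm.quotientFunc (ModularForm.translate f (glCast g)) q =
        ⇑f ∣[k] α (orbitIndexQuot α hα' q) := by
    intro q
    induction q using Quotient.inductionOn with
    | h r =>
      rw [SlashInvariantForm.quotientFunc_mk, orbitIndexQuot_mk, ModularForm.coe_translate,
        ← SlashAction.slash_mul]
      set γ := glCast g * (r : GL (Fin 2) ℝ)⁻¹ * (α (orbitIndex α hα' r))⁻¹ with hγ
      have hγmem : γ ∈ Γ := orbitIndex_spec α hα' r
      have : glCast g * (r : GL (Fin 2) ℝ)⁻¹ = γ * α (orbitIndex α hα' r) := by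
        simp [hγ]
      rw [this, SlashAction.slash_mul, SlashInvariantFormClass.slash_action_eq f γ hγmem]
  change ⇑(ModularForm.trace Γ' (ModularForm.translate f (glCast g))) = _
  rw [ModularForm.coe_trace]
  exact Fintype.sum_bijective _ (orbitIndexQuot_bijective α hα' hα)
    (SlashInvariantForm.quotientFunc _) (fun i ↦ ⇑f ∣[k] α i) key

/-- Discharge of `heckeOperator_apply_eq_sum_slash` (the case `Γ' = Γ` of the double coset
formula; Shimura 1971, (3.4.4); Diamond–Shurman (5.1)). [cite: DiamondShurman2005, Def. 5.1.3] -/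
theorem heckeOperator_apply_eq_sum_slash_holds : heckeOperator_apply_eq_sum_slash :=
  fun Γ _ k g _ _ α hα hα' f ↦
    heckeCorrespondence_apply_eq_sum_slash_holds Γ Γ k g α hα hα' f

/-! ### Coset representatives for `Γ₀(N) diag(1, p) Γ₀(N)` (Diamond–Shurman §5.2, (5.2)) -/

section Gamma0Cosets

open CongruenceSubgroup Matrix ModularGroup

variable (p : ℕ) [NeZero p]

/-- `tpG p = diag(1, p) ∈ GL(2, ℝ)`, the image of `diagGL 1 p`; `heckeT Γ k p = [Γ (tpG p) Γ]`
(Diamond–Shurman §5.2, `α = (1 0; 0 p)`). [folklore] -/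
def tpG : GL (Fin 2) ℝ :=
  glCast (diagGL 1 p one_pos (Nat.cast_pos.mpr (NeZero.pos p)) : GL (Fin 2) ℚ)

/-- `tpD p = diag(p, 1) ∈ GL(2, ℝ)` (Diamond–Shurman (5.2), `β_∞` for `Γ₀(N)`). [folklore] -/
def tpD : GL (Fin 2) ℝ :=
  glCast (diagGL p 1 (Nat.cast_pos.mpr (NeZero.pos p)) one_pos : GL (Fin 2) ℚ)

/-- `tpB p j = diag(1, p) Tʲ = (1 j; 0 p) ∈ GL(2, ℝ)` (Diamond–Shurman (5.2), `βⱼ`). [folklore] -/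
def tpB (j : ℤ) : GL (Fin 2) ℝ := tpG p * Matrix.SpecialLinearGroup.mapGL ℝ (T ^ j)

/-- The matrix of `tpG p` is `(1 0; 0 p)`. [folklore] -/
lemma val_tpG : ((tpG p : GL (Fin 2) ℝ) : Matrix (Fin 2) (Fin 2) ℝ) = !![1, 0; 0, (p : ℝ)] := by
  ext i j
  fin_cases i <;> fin_cases j <;> simp [tpG, glCast, coe_coe_diagGL]

/-- The matrix of `tpD p` is `(p 0; 0 1)`. [folklore] -/
lemma val_tpD : ((tpD p : GL (Fin 2) ℝ) : Matrix (Fin 2) (Fin 2) ℝ) = !![(p : ℝ), 0; 0, 1] := by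
  ext i j
  fin_cases i <;> fin_cases j <;> simp [tpD, glCast, coe_coe_diagGL]

/-- The matrix of the image of `γ ∈ SL(2, ℤ)` in `GL(2, ℝ)` is the entrywise cast. [folklore] -/
lemma val_mapGL' (γ : SL(2, ℤ)) :
    ((Matrix.SpecialLinearGroup.mapGL ℝ γ : GL (Fin 2) ℝ) : Matrix (Fin 2) (Fin 2) ℝ) =
      (γ : Matrix (Fin 2) (Fin 2) ℤ).map (fun x : ℤ ↦ (x : ℝ)) := by
  ext i j; simp

/-- The matrix of `tpB p j` is `(1 j; 0 p)`. [folklore] -/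
lemma val_tpB (j : ℤ) :
    ((tpB p j : GL (Fin 2) ℝ) : Matrix (Fin 2) (Fin 2) ℝ) = !![1, (j : ℝ); 0, (p : ℝ)] := by
  rw [tpB, Matrix.GeneralLinearGroup.coe_mul, val_tpG, val_mapGL', coe_T_zpow]
  ext i j
  fin_cases i <;> fin_cases j <;> simp [Matrix.mul_apply, Fin.sum_univ_two]

example (γ : GL (Fin 2) ℝ) : (γ * tpG p) 0 1 = γ 0 1 * p := by
  simp [val_tpG, Matrix.mul_apply, Fin.sum_univ_two]


/-! #### Arithmetic of the coset indices -/

/-- For `p ∤ a` there is a unique `j mod p` with `p ∣ b - j a`. [folklore] -/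
lemma existsUnique_fin_dvd_sub_mul {p : ℕ} [Fact p.Prime] {a : ℤ} (b : ℤ)
    (ha : ¬ (p : ℤ) ∣ a) : ∃! j : Fin p, (p : ℤ) ∣ b - (j : ℕ) * a := by
  have ha' : (a : ZMod p) ≠ 0 := by rwa [Ne, ZMod.intCast_zmod_eq_zero_iff_dvd]
  set j₀ : ZMod p := (b : ZMod p) * (a : ZMod p)⁻¹ with hj₀
  refine ⟨⟨j₀.val, ZMod.val_lt j₀⟩, ?_, ?_⟩
  · simp only
    rw [← ZMod.intCast_zmod_eq_zero_iff_dvd]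
    push_cast
    rw [ZMod.natCast_zmod_val, hj₀, inv_mul_cancel_right₀ ha', sub_self]
  · intro j hj
    rw [← ZMod.intCast_zmod_eq_zero_iff_dvd] at hj
    push_cast at hj
    have hj' : ((j : ℕ) : ZMod p) = j₀ := by
      rw [sub_eq_zero] at hj
      rw [hj₀, hj, mul_inv_cancel_right₀ ha']
    ext
    have := congrArg ZMod.val hj'
    rwa [ZMod.val_natCast_of_lt j.2] at this

/-- If `p ∣ a` and `ad - bc = 1` then `p ∤ b - j a` for every `j`. [folklore] -/
lemma not_dvd_sub_mul_of_dvd {p : ℕ} [hp : Fact p.Prime] {a b c d : ℤ} (hdet : a * d - b * c = 1)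
    (ha : (p : ℤ) ∣ a) (j : ℤ) : ¬ (p : ℤ) ∣ b - j * a := by
  intro h
  have hb : (p : ℤ) ∣ b := by simpa using dvd_add h (dvd_mul_of_dvd_right ha j)
  have : (p : ℤ) ∣ 1 := by
    rw [← hdet]; exact dvd_sub (dvd_mul_of_dvd_left ha d) (dvd_mul_of_dvd_left hb c)
  exact hp.out.not_dvd_one (Int.natCast_dvd_natCast.mp this)

/-- If `p ∣ c` and `ad - bc = 1` then `p ∤ a`. [folklore] -/
lemma not_dvd_of_dvd {p : ℕ} [hp : Fact p.Prime] {a b c d : ℤ} (hdet : a * d - b * c = 1)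
    (hc : (p : ℤ) ∣ c) : ¬ (p : ℤ) ∣ a := by
  intro ha
  have : (p : ℤ) ∣ 1 := by
    rw [← hdet]; exact dvd_sub (dvd_mul_of_dvd_left ha d) (dvd_mul_of_dvd_right hc b)
  exact hp.out.not_dvd_one (Int.natCast_dvd_natCast.mp this)

/-! #### Membership criteria in `Γ₀(N) ≤ GL(2, ℝ)` -/

variable (N : ℕ)

/-- `ad - bc = 1` for `(a b; c d) ∈ SL(2, ℤ)`. [folklore] -/
lemma det_entries (M : SL(2, ℤ)) : M 0 0 * M 1 1 - M 0 1 * M 1 0 = 1 := by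
  have := M.det_coe
  rwa [Matrix.det_fin_two] at this

/-- `N ∣ c` for `(a b; c d) ∈ Γ₀(N)`. [folklore] -/
lemma dvd_entry_of_mem_Gamma0 {M : SL(2, ℤ)} (hM : M ∈ Gamma0 N) : (N : ℤ) ∣ M 1 0 := by
  rw [Gamma0_mem] at hM
  exact (ZMod.intCast_zmod_eq_zero_iff_dvd _ _).mp hM

/-- `G M G⁻¹ ∈ Γ₀(N)` iff `p ∣ M₀₁`, for `M ∈ Γ₀(N)` and `G = diag(1, p)` (Diamond–Shurman §5.2:
`Γ₃ = Γ₀(N) ∩ Γ⁰(p)`), phrased without inverses. [folklore] -/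
lemma exists_mul_tpG_eq_iff {M : SL(2, ℤ)} (hM : M ∈ Gamma0 N) :
    (∃ γ ∈ ((Gamma0 N : Subgroup SL(2, ℤ)) : Subgroup (GL (Fin 2) ℝ)),
      γ * tpG p = tpG p * Matrix.SpecialLinearGroup.mapGL ℝ M) ↔ (p : ℤ) ∣ M 0 1 := by
  constructor
  · rintro ⟨γ, hγ, h⟩
    obtain ⟨g, -, rfl⟩ := Subgroup.mem_map.mp hγ
    have h01 := congrArg (fun A : GL (Fin 2) ℝ ↦ (A : Matrix (Fin 2) (Fin 2) ℝ) 0 1) h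
    simp only [Matrix.GeneralLinearGroup.coe_mul, val_tpG, val_mapGL', Matrix.mul_apply,
      Fin.sum_univ_two] at h01
    simp at h01
    refine ⟨g 0 1, ?_⟩
    exact_mod_cast (by rw [← h01]; ring : (M 0 1 : ℝ) = p * g 0 1)
  · rintro ⟨b, hb⟩
    have hdet := det_entries M
    let γ : SL(2, ℤ) := ⟨!![M 0 0, b; p * M 1 0, M 1 1], by
      rw [Matrix.det_fin_two_of]; linear_combination hdet + (M 1 0) * hb⟩
    have hγ : γ ∈ Gamma0 N := by
      have := Gamma0_mem.mp hM
      simp [Gamma0_mem, γ, this]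
    refine ⟨_, Subgroup.mem_map_of_mem _ hγ, ?_⟩
    ext i j
    fin_cases i <;> fin_cases j <;>
      simp [val_tpG, Matrix.mul_apply, Fin.sum_univ_two, γ, hb] <;> ring

/-- `G M D⁻¹ ∈ Γ₀(N)` iff `p ∣ M₀₀`, for `M ∈ Γ₀(N)`, `G = diag(1, p)`, `D = diag(p, 1)`. [folklore] -/
lemma exists_mul_tpD_eq_iff {M : SL(2, ℤ)} (hM : M ∈ Gamma0 N) :
    (∃ γ ∈ ((Gamma0 N : Subgroup SL(2, ℤ)) : Subgroup (GL (Fin 2) ℝ)),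
      γ * tpD p = tpG p * Matrix.SpecialLinearGroup.mapGL ℝ M) ↔ (p : ℤ) ∣ M 0 0 := by
  constructor
  · rintro ⟨γ, hγ, h⟩
    obtain ⟨g, -, rfl⟩ := Subgroup.mem_map.mp hγ
    have h00 := congrArg (fun A : GL (Fin 2) ℝ ↦ (A : Matrix (Fin 2) (Fin 2) ℝ) 0 0) h
    simp only [Matrix.GeneralLinearGroup.coe_mul, val_tpD, val_tpG, val_mapGL', Matrix.mul_apply,
      Fin.sum_univ_two] at h00
    simp at h00
    refine ⟨g 0 0, ?_⟩
    exact_mod_cast (by rw [← h00]; ring : (M 0 0 : ℝ) = p * g 0 0)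
  · rintro ⟨a, ha⟩
    have hdet := det_entries M
    let γ : SL(2, ℤ) := ⟨!![a, M 0 1; M 1 0, p * M 1 1], by
      rw [Matrix.det_fin_two_of]; linear_combination hdet - (M 1 1) * ha⟩
    have hγ : γ ∈ Gamma0 N := by
      have := Gamma0_mem.mp hM
      simp [Gamma0_mem, γ, this]
    refine ⟨_, Subgroup.mem_map_of_mem _ hγ, ?_⟩
    ext i j
    fin_cases i <;> fin_cases j <;>
      simp [val_tpD, val_tpG, Matrix.mul_apply, Fin.sum_univ_two, γ, ha] <;> ring


/-- `T = (1 1; 0 1) ∈ Γ₀(N)`. [folklore] -/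
lemma T_mem_Gamma0 : T ∈ Gamma0 N := by
  simp [Gamma0_mem, coe_T]

/-- `Tʲ ∈ Γ₀(N)`. [folklore] -/
lemma T_zpow_mem_Gamma0 (j : ℤ) : T ^ j ∈ Gamma0 N :=
  zpow_mem (T_mem_Gamma0 N) j

/-- `x₁ G x₂ A⁻¹ ∈ Γ ↔ ∃ γ ∈ Γ, γ A = G x₂`, for `x₁ ∈ Γ`. [folklore] -/
lemma mul_inv_mem_iff_exists {Γ : Subgroup (GL (Fin 2) ℝ)} {x₁ x₂ G A : GL (Fin 2) ℝ}
    (h₁ : x₁ ∈ Γ) : x₁ * G * x₂ * A⁻¹ ∈ Γ ↔ ∃ γ ∈ Γ, γ * A = G * x₂ := by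
  constructor
  · intro h
    exact ⟨x₁⁻¹ * (x₁ * G * x₂ * A⁻¹), Γ.mul_mem (Γ.inv_mem h₁) h, by simp [mul_assoc]⟩
  · rintro ⟨γ, hγ, hγA⟩
    have : x₁ * G * x₂ * A⁻¹ = x₁ * γ := by
      rw [mul_assoc x₁ G, ← hγA]; simp [mul_assoc]
    rw [this]
    exact Γ.mul_mem h₁ hγ

/-- `γ βⱼ = G M` is solvable in `Γ₀(N)` iff `p ∣ M₀₁ - j M₀₀` (Diamond–Shurman §5.2, p. 170). [folklore] -/
lemma exists_mul_tpB_eq_iff {M : SL(2, ℤ)} (hM : M ∈ Gamma0 N) (j : ℤ) :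
    (∃ γ ∈ ((Gamma0 N : Subgroup SL(2, ℤ)) : Subgroup (GL (Fin 2) ℝ)),
      γ * tpB p j = tpG p * Matrix.SpecialLinearGroup.mapGL ℝ M) ↔
      (p : ℤ) ∣ M 0 1 - j * M 0 0 := by
  have hMT : M * T ^ (-j) ∈ Gamma0 N := mul_mem hM (T_zpow_mem_Gamma0 N (-j))
  have key := exists_mul_tpG_eq_iff p N hMT
  have h01 : (M * T ^ (-j)) 0 1 = M 0 1 - j * M 0 0 := by
    change ((M : Matrix (Fin 2) (Fin 2) ℤ) * (T ^ (-j) : SL(2, ℤ))) 0 1 = _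
    rw [coe_T_zpow]
    simp [Matrix.mul_apply, Fin.sum_univ_two]
    ring
  rw [h01] at key
  rw [← key]
  refine exists_congr fun γ ↦ and_congr_right fun _ ↦ ?_
  rw [tpB, map_mul, map_zpow _ T (-j), _root_.zpow_neg, ← map_zpow, ← mul_assoc (tpG p),
    eq_mul_inv_iff_mul_eq, mul_assoc]

/-- `βⱼ = diag(1, p) Tʲ ∈ Γ₀(N) diag(1, p) Γ₀(N)`. [folklore] -/
lemma tpB_mem_doubleCoset (j : ℤ) :
    tpB p j ∈ DoubleCoset.doubleCoset (tpG p)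
      (((Gamma0 N : Subgroup SL(2, ℤ)) : Subgroup (GL (Fin 2) ℝ)) : Set (GL (Fin 2) ℝ))
      (((Gamma0 N : Subgroup SL(2, ℤ)) : Subgroup (GL (Fin 2) ℝ)) : Set (GL (Fin 2) ℝ)) :=
  DoubleCoset.mem_doubleCoset.mpr ⟨1, one_mem _, _, Subgroup.mem_map_of_mem _ (T_zpow_mem_Gamma0 N j),
    by simp [tpB]⟩

/-- For `p ∤ N`, `diag(p, 1) ∈ Γ₀(N) diag(1, p) Γ₀(N)`: with `mp - nN = 1`,
`diag(p, 1) = (pm n; N 1) · diag(1, p) · (p -n; -N m)` (cf. Diamond–Shurman (5.2)). [folklore] -/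
lemma tpD_mem_doubleCoset [Fact p.Prime] (hpN : ¬ p ∣ N) :
    tpD p ∈ DoubleCoset.doubleCoset (tpG p)
      (((Gamma0 N : Subgroup SL(2, ℤ)) : Subgroup (GL (Fin 2) ℝ)) : Set (GL (Fin 2) ℝ))
      (((Gamma0 N : Subgroup SL(2, ℤ)) : Subgroup (GL (Fin 2) ℝ)) : Set (GL (Fin 2) ℝ)) := by
  have hcop : IsCoprime (p : ℤ) (N : ℤ) :=
    Nat.isCoprime_iff_coprime.mpr ((Nat.Prime.coprime_iff_not_dvd Fact.out).mpr hpN)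
  obtain ⟨m, v, hmv⟩ := hcop
  set n := -v with hn
  have h : m * p - n * N = 1 := by rw [hn]; linear_combination hmv
  let γ₁ : SL(2, ℤ) := ⟨!![p * m, n; N, 1], by rw [Matrix.det_fin_two_of]; linear_combination h⟩
  let γ₂ : SL(2, ℤ) := ⟨!![p, -n; -N, m], by rw [Matrix.det_fin_two_of]; linear_combination h⟩
  have h₁ : γ₁ ∈ Gamma0 N := by simp [Gamma0_mem, γ₁]
  have h₂ : γ₂ ∈ Gamma0 N := by simp [Gamma0_mem, γ₂]
  refine DoubleCoset.mem_doubleCoset.mpr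
    ⟨_, Subgroup.mem_map_of_mem _ h₁, _, Subgroup.mem_map_of_mem _ h₂, ?_⟩
  have h' : (m : ℝ) * p - n * N = 1 := by exact_mod_cast h
  ext i j
  fin_cases i <;> fin_cases j <;>
    simp [val_tpD, val_tpG, Matrix.mul_apply, Fin.sum_univ_two, γ₁, γ₂] <;>
    first | linear_combination -h' | linear_combination (-(p : ℝ)) * h' | ring

/-- Coset decomposition `Γ₀(N) diag(1,p) Γ₀(N) = ⊔_{j mod p} Γ₀(N) βⱼ` for `p ∣ N`
(Diamond–Shurman (5.2) and Ex. 5.2.4). [folklore] -/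
lemma existsUnique_fin [Fact p.Prime] (hpN : p ∣ N) (x : GL (Fin 2) ℝ)
    (hx : x ∈ DoubleCoset.doubleCoset (tpG p)
      (((Gamma0 N : Subgroup SL(2, ℤ)) : Subgroup (GL (Fin 2) ℝ)) : Set (GL (Fin 2) ℝ))
      (((Gamma0 N : Subgroup SL(2, ℤ)) : Subgroup (GL (Fin 2) ℝ)) : Set (GL (Fin 2) ℝ))) :
    ∃! j : Fin p, x * (tpB p ((j : ℕ) : ℤ))⁻¹ ∈
      ((Gamma0 N : Subgroup SL(2, ℤ)) : Subgroup (GL (Fin 2) ℝ)) := by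
  obtain ⟨x₁, hx₁, x₂, hx₂, rfl⟩ := DoubleCoset.mem_doubleCoset.mp hx
  obtain ⟨M, hM, rfl⟩ := Subgroup.mem_map.mp hx₂
  simp_rw [mul_inv_mem_iff_exists hx₁, exists_mul_tpB_eq_iff p N hM]
  refine existsUnique_fin_dvd_sub_mul (M 0 1) ?_
  exact not_dvd_of_dvd (det_entries M)
    ((Int.natCast_dvd_natCast.mpr hpN).trans (dvd_entry_of_mem_Gamma0 N hM))

/-- Coset decomposition `Γ₀(N) diag(1,p) Γ₀(N) = ⊔_{j mod p} Γ₀(N) βⱼ ⊔ Γ₀(N) diag(p, 1)`, valid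
when `p ∤ N` (Diamond–Shurman (5.2) and Ex. 5.2.4; for `p ∣ N` the last orbit is empty). [folklore] -/
lemma existsUnique_option [Fact p.Prime] (x : GL (Fin 2) ℝ)
    (hx : x ∈ DoubleCoset.doubleCoset (tpG p)
      (((Gamma0 N : Subgroup SL(2, ℤ)) : Subgroup (GL (Fin 2) ℝ)) : Set (GL (Fin 2) ℝ))
      (((Gamma0 N : Subgroup SL(2, ℤ)) : Subgroup (GL (Fin 2) ℝ)) : Set (GL (Fin 2) ℝ))) :
    ∃! i : Option (Fin p), x * (i.elim (tpD p) fun j ↦ tpB p ((j : ℕ) : ℤ))⁻¹ ∈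
      ((Gamma0 N : Subgroup SL(2, ℤ)) : Subgroup (GL (Fin 2) ℝ)) := by
  obtain ⟨x₁, hx₁, x₂, hx₂, rfl⟩ := DoubleCoset.mem_doubleCoset.mp hx
  obtain ⟨M, hM, rfl⟩ := Subgroup.mem_map.mp hx₂
  have hdet := det_entries M
  by_cases ha : (p : ℤ) ∣ M 0 0
  · refine ⟨none, ?_, ?_⟩
    · simp only [Option.elim]
      rw [mul_inv_mem_iff_exists hx₁, exists_mul_tpD_eq_iff p N hM]
      exact ha
    · rintro (_ | j) hj
      · rfl
      exfalso
      simp only [Option.elim] at hj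
      rw [mul_inv_mem_iff_exists hx₁, exists_mul_tpB_eq_iff p N hM] at hj
      exact not_dvd_sub_mul_of_dvd hdet ha _ hj
  · obtain ⟨j, hj, hju⟩ := existsUnique_fin_dvd_sub_mul (M 0 1) ha
    refine ⟨some j, ?_, ?_⟩
    · simp only [Option.elim]
      rw [mul_inv_mem_iff_exists hx₁, exists_mul_tpB_eq_iff p N hM]
      exact_mod_cast hj
    · rintro (_ | j') hj'
      · exfalso
        simp only [Option.elim] at hj'
        rw [mul_inv_mem_iff_exists hx₁, exists_mul_tpD_eq_iff p N hM] at hj'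
        exact ha hj'
      · simp only [Option.elim] at hj'
        rw [mul_inv_mem_iff_exists hx₁, exists_mul_tpB_eq_iff p N hM] at hj'
        rw [hju j' (by exact_mod_cast hj')]

end Gamma0Cosets

/-! ### `T_p` on `Γ₀(N)` as an explicit sum (Diamond–Shurman Prop. 5.2.1) -/

section TpSum

open CongruenceSubgroup

variable (N : ℕ) [NeZero N] (k : ℤ) (p : ℕ) [NeZero p]

/-- **Diamond–Shurman Prop. 5.2.1 for `Γ₀(N)`**: for `p` prime and `f ∈ S_k(Γ₀(N))`,
`T_p f = ∑_{j mod p} f ∣[k] (1 j; 0 p) + 𝟙_{p ∤ N} · f ∣[k] diag(p, 1)`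
(Diamond–Shurman Prop. 5.2.1 and the remark after it, p. 171: for `Γ₀(N)` the last representative
`(m n; N p) diag(p, 1)` may be replaced by `diag(p, 1)`). [cite: DiamondShurman2005, Prop. 5.2.1] -/
theorem coe_heckeT_gamma0_eq_sum (hp : p.Prime) (f : CuspForm (Gamma0 N) k) :
    ⇑(heckeT (Gamma0 N) k p f) =
      ∑ j : Fin p, ⇑f ∣[k] tpB p ((j : ℕ) : ℤ) + if p ∣ N then 0 else ⇑f ∣[k] tpD p := by
  haveI : Fact p.Prime := ⟨hp⟩
  have h0 : ⇑(heckeT (Gamma0 N) k p f) =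
      ⇑(heckeCorrespondence (Gamma0 N) (Gamma0 N) k
        (diagGL 1 p one_pos (Nat.cast_pos.mpr (NeZero.pos p))) (f : ModularForm (Gamma0 N) k)) :=
    rfl
  rw [h0]
  by_cases hpN : p ∣ N
  · rw [if_pos hpN, add_zero]
    exact heckeCorrespondence_apply_eq_sum_slash_holds _ _ k _ (fun j : Fin p ↦ tpB p ((j : ℕ) : ℤ))
      (fun j ↦ tpB_mem_doubleCoset p N _) (existsUnique_fin p N hpN) _
  · rw [if_neg hpN, heckeCorrespondence_apply_eq_sum_slash_holds _ _ k _
      (fun i : Option (Fin p) ↦ i.elim (tpD p) fun j ↦ tpB p ((j : ℕ) : ℤ))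
      (by rintro (_ | j); exacts [tpD_mem_doubleCoset p N hpN, tpB_mem_doubleCoset p N _])
      (existsUnique_option p N) _, Fintype.sum_option, add_comm]
    rfl

end TpSum

/-! ### Fourier coefficients of `T_p f` (Diamond–Shurman Prop. 5.2.2) -/

section Fourier

open CongruenceSubgroup Function

variable (p : ℕ) [NeZero p]

/-- `det (tpB p j) = p`. [folklore] -/
lemma det_tpB (j : ℤ) : (tpB p j).det.val = (p : ℝ) := by
  simp [Matrix.GeneralLinearGroup.val_det_apply, val_tpB, Matrix.det_fin_two_of]

/-- `det (tpD p) = p`. [folklore] -/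
lemma det_tpD : (tpD p).det.val = (p : ℝ) := by
  simp [Matrix.GeneralLinearGroup.val_det_apply, val_tpD, Matrix.det_fin_two_of]

/-- Mathlib's `UpperHalfPlane.σ g` is the identity for `det g > 0`. [folklore] -/
lemma σ_eq_self {g : GL (Fin 2) ℝ} (h : 0 < g.det.val) (z : ℂ) : σ g z = z := by
  rw [σ, if_pos h]
  rfl

/-- `j((1 j; 0 p), τ) = p`. [folklore] -/
lemma denom_tpB (j : ℤ) (τ : ℍ) : denom (tpB p j) τ = p := by
  simp [denom, val_tpB]

/-- `j(diag(p, 1), τ) = 1`. [folklore] -/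
lemma denom_tpD (τ : ℍ) : denom (tpD p) τ = 1 := by
  simp [denom, val_tpD]

/-- `(1 j; 0 p) · τ = (τ + j)/p`. [folklore] -/
lemma coe_tpB_smul (j : ℤ) (τ : ℍ) : ((tpB p j • τ : ℍ) : ℂ) = ((τ : ℂ) + j) / p := by
  have h : 0 < (tpB p j).det.val := by rw [det_tpB]; exact_mod_cast NeZero.pos p
  rw [coe_smul_of_det_pos h, denom_tpB]
  simp [num, val_tpB]

/-- `diag(p, 1) · τ = p τ`. [folklore] -/
lemma coe_tpD_smul (τ : ℍ) : ((tpD p • τ : ℍ) : ℂ) = p * (τ : ℂ) := by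
  have h : 0 < (tpD p).det.val := by rw [det_tpD]; exact_mod_cast NeZero.pos p
  rw [coe_smul_of_det_pos h, denom_tpD]
  simp [num, val_tpD]

/-- `(f ∣[k] (1 j; 0 p))(τ) = p⁻¹ f((τ + j)/p)` (Diamond–Shurman, proof of Prop. 5.2.2). [cite: DiamondShurman2005, proof of Prop. 5.2.2] -/
lemma slash_tpB_apply (k : ℤ) (f : ℍ → ℂ) (j : ℤ) (τ : ℍ) :
    (f ∣[k] tpB p j) τ = (p : ℂ)⁻¹ * f (tpB p j • τ) := by
  have hp : (0 : ℝ) < p := by exact_mod_cast NeZero.pos p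
  have h : 0 < (tpB p j).det.val := by rw [det_tpB]; exact hp
  rw [ModularForm.slash_apply, σ_eq_self h, det_tpB, denom_tpB, abs_of_pos hp,
    ofReal_natCast, mul_assoc, ← zpow_add₀ (by exact_mod_cast (NeZero.ne p) : (p : ℂ) ≠ 0)]
  rw [show k - 1 + -k = -1 by ring, zpow_neg_one, mul_comm]

/-- `(f ∣[k] diag(p, 1))(τ) = p^{k-1} f(pτ)` (Diamond–Shurman, proof of Prop. 5.2.2). [cite: DiamondShurman2005, proof of Prop. 5.2.2] -/
lemma slash_tpD_apply (k : ℤ) (f : ℍ → ℂ) (τ : ℍ) :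
    (f ∣[k] tpD p) τ = (p : ℂ) ^ (k - 1) * f (tpD p • τ) := by
  have hp : (0 : ℝ) < p := by exact_mod_cast NeZero.pos p
  have h : 0 < (tpD p).det.val := by rw [det_tpD]; exact hp
  rw [ModularForm.slash_apply, σ_eq_self h, det_tpD, denom_tpD, abs_of_pos hp,
    ofReal_natCast, one_zpow, mul_one, mul_comm]

/-- The primitive `p`-th root of unity `ζ_p = e^{2πi/p}` (`μ_p` in Diamond–Shurman, proof of
Prop. 5.2.2). [folklore] -/
def ζp : ℂ := exp (2 * π * I / p)

/-- `q((τ + j)/p)^m = e^{2πimτ/p} ζ_p^{mj}` (Diamond–Shurman, proof of Prop. 5.2.2). [folklore] -/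
lemma qParam_tpB_smul_pow (j : ℤ) (τ : ℍ) (m : ℕ) :
    Periodic.qParam 1 ((tpB p j • τ : ℍ) : ℂ) ^ m =
      exp (2 * π * I * m * τ / p) * ζp p ^ (m * j : ℤ) := by
  simp only [coe_tpB_smul, Periodic.qParam, ζp]
  rw [← exp_nat_mul, ← exp_int_mul, ← exp_add]
  congr 1
  push_cast
  ring

/-- `q(pτ)^m = q(τ)^{pm}`. [folklore] -/
lemma qParam_tpD_smul_pow (τ : ℍ) (m : ℕ) :
    Periodic.qParam 1 ((tpD p • τ : ℍ) : ℂ) ^ m = Periodic.qParam 1 (τ : ℂ) ^ (p * m) := by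
  simp only [coe_tpD_smul, Periodic.qParam]
  rw [← exp_nat_mul, ← exp_nat_mul]
  congr 1
  push_cast
  ring

/-- `e^{2πi(pn)τ/p} = q(τ)ⁿ`. [folklore] -/
lemma exp_mul_eq_qParam_pow (τ : ℍ) (n : ℕ) :
    exp (2 * π * I * (p * n : ℕ) * τ / p) = Periodic.qParam 1 (τ : ℂ) ^ n := by
  simp only [Periodic.qParam]
  rw [← exp_nat_mul]
  congr 1
  have : (p : ℂ) ≠ 0 := by exact_mod_cast NeZero.ne p
  push_cast
  field_simp

omit [NeZero p] in
/-- `∑_{j mod p} ζ_p^{mj} = p · 𝟙_{p ∣ m}` (orthogonality of characters of `ℤ/pℤ`;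
Diamond–Shurman, proof of Prop. 5.2.2: "the geometric sum is `p` when `p ∣ n` and `0` otherwise"). [folklore] -/
lemma sum_ζp_pow (hp : p.Prime) (m : ℕ) :
    ∑ j : Fin p, ζp p ^ (m * ((j : ℕ) : ℤ) : ℤ) = if p ∣ m then (p : ℂ) else 0 := by
  have hζ : IsPrimitiveRoot (ζp p) p := Complex.isPrimitiveRoot_exp p hp.ne_zero
  have : ∀ j : Fin p, ζp p ^ (m * ((j : ℕ) : ℤ) : ℤ) = (ζp p ^ m) ^ (j : ℕ) := fun j ↦ by
    rw [← zpow_natCast, ← zpow_natCast, ← zpow_mul]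
  simp_rw [this]
  rw [Fin.sum_univ_eq_sum_range (fun j ↦ (ζp p ^ m) ^ j) p]
  split_ifs with h
  · rw [(hζ.pow_eq_one_iff_dvd m).mpr h]
    simp
  · have h1 : ζp p ^ m ≠ 1 := fun h' ↦ h ((hζ.pow_eq_one_iff_dvd m).mp h')
    rw [geom_sum_eq h1, ← pow_mul, mul_comm, pow_mul, hζ.pow_eq_one, one_pow, sub_self, zero_div]

end Fourier

/-! ### Assembly: `q`-expansion of `T_p f` on `Γ₀(N)` -/

section Assembly

open CongruenceSubgroup Function

variable (N : ℕ) [NeZero N] (k : ℤ) (p : ℕ) [NeZero p]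

omit [NeZero N] in
/-- `1` is a strict period of `Γ₀(N)` (`T ∈ Γ₀(N)`). [folklore] -/
lemma one_mem_strictPeriods_gamma0 :
    (1 : ℝ) ∈ ((Gamma0 N : Subgroup SL(2, ℤ)) : Subgroup (GL (Fin 2) ℝ)).strictPeriods := by
  rw [Subgroup.strictPeriods_eq_zmultiples_one_of_T_mem (T_mem_Gamma0 N)]
  exact AddSubgroup.mem_zmultiples 1

/-- The `q`-expansion of `f ∈ S_k(Γ₀(N))` converges to `f` at every point of `ℍ`
(Mathlib's `UpperHalfPlane.hasSum_qExpansion`, specialised). [folklore] -/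
lemma hasSum_qExpansion_gamma0 (f : CuspForm (Gamma0 N) k) (z : ℍ) :
    HasSum (fun m : ℕ ↦ (qExpansion 1 ⇑f).coeff m • Periodic.qParam 1 (z : ℂ) ^ m) (f z) :=
  UpperHalfPlane.hasSum_qExpansion one_pos
    (SlashInvariantFormClass.periodic_comp_ofComplex f (one_mem_strictPeriods_gamma0 N))
    (ModularFormClass.holo f) (ModularFormClass.bdd_at_infty f) z

/-- `∑_{j mod p} f ∣[k] (1 j; 0 p) = ∑_n a_{pn}(f) qⁿ` (Diamond–Shurman, proof of Prop. 5.2.2(a)). [cite: DiamondShurman2005, proof of Prop. 5.2.2(a)] -/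
lemma hasSum_sum_slash_tpB (hp : p.Prime) (f : CuspForm (Gamma0 N) k) (τ : ℍ) :
    HasSum (fun n : ℕ ↦ (qExpansion 1 ⇑f).coeff (p * n) • Periodic.qParam 1 (τ : ℂ) ^ n)
      ((∑ j : Fin p, ⇑f ∣[k] tpB p ((j : ℕ) : ℤ)) τ) := by
  have hp0 : (p : ℂ) ≠ 0 := by exact_mod_cast hp.ne_zero
  set a : ℕ → ℂ := fun m ↦ (qExpansion 1 ⇑f).coeff m with ha
  set E : ℕ → ℂ := fun m ↦ exp (2 * π * Complex.I * m * τ / p) with hE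
  have h1 : ∀ j : Fin p, HasSum (fun m : ℕ ↦
      (p : ℂ)⁻¹ * (a m * (E m * ζp p ^ ((m * ((j : ℕ) : ℤ) : ℤ)))))
      ((⇑f ∣[k] tpB p ((j : ℕ) : ℤ)) τ) := fun j ↦ by
    rw [slash_tpB_apply]
    refine HasSum.mul_left _ ?_
    simpa only [smul_eq_mul, qParam_tpB_smul_pow] using
      hasSum_qExpansion_gamma0 N k f (tpB p ((j : ℕ) : ℤ) • τ)
  have h3 : ∀ m : ℕ, ∑ j : Fin p, (p : ℂ)⁻¹ * (a m * (E m * ζp p ^ ((m * ((j : ℕ) : ℤ) : ℤ))))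
      = if p ∣ m then a m * E m else 0 := fun m ↦ by
    simp_rw [← mul_assoc]
    rw [← Finset.mul_sum, sum_ζp_pow p hp m]
    split_ifs
    · field_simp
    · rw [mul_zero]
  have h2 : HasSum (fun m : ℕ ↦ if p ∣ m then a m * E m else 0)
      (∑ j : Fin p, (⇑f ∣[k] tpB p ((j : ℕ) : ℤ)) τ) := by
    have := hasSum_sum fun j (_ : j ∈ Finset.univ) ↦ h1 j
    simpa only [h3] using this
  have hinj : Function.Injective (fun n : ℕ ↦ p * n) := mul_right_injective₀ hp.ne_zero
  rw [Finset.sum_apply]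
  convert (hinj.hasSum_iff ?_).mpr h2 using 1
  · funext n
    simp only [Function.comp_apply, if_pos (dvd_mul_right p n), smul_eq_mul, hE,
      exp_mul_eq_qParam_pow]
    rfl
  · intro x hx
    rw [if_neg]
    rintro ⟨c, rfl⟩
    exact hx ⟨c, rfl⟩

/-- `f ∣[k] diag(p, 1) = p^{k-1} ∑_n a_n(f) q^{pn}`, i.e. its `n`-th coefficient is
`p^{k-1} a_{n/p}(f) 𝟙_{p ∣ n}` (Diamond–Shurman, proof of Prop. 5.2.2(a)). [cite: DiamondShurman2005, proof of Prop. 5.2.2(a)] -/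
lemma hasSum_slash_tpD (hp : p.Prime) (f : CuspForm (Gamma0 N) k) (τ : ℍ) :
    HasSum (fun n : ℕ ↦ ((p : ℂ) ^ (k - 1) *
        (if p ∣ n then (qExpansion 1 ⇑f).coeff (n / p) else 0)) • Periodic.qParam 1 (τ : ℂ) ^ n)
      ((⇑f ∣[k] tpD p) τ) := by
  have h1 : HasSum (fun m : ℕ ↦ (p : ℂ) ^ (k - 1) *
      ((qExpansion 1 ⇑f).coeff m * Periodic.qParam 1 (τ : ℂ) ^ (p * m))) ((⇑f ∣[k] tpD p) τ) := by
    rw [slash_tpD_apply]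
    refine HasSum.mul_left _ ?_
    simpa only [smul_eq_mul, qParam_tpD_smul_pow] using hasSum_qExpansion_gamma0 N k f (tpD p • τ)
  have hinj : Function.Injective (fun m : ℕ ↦ p * m) := mul_right_injective₀ hp.ne_zero
  refine (hinj.hasSum_iff ?_).mp ?_
  · intro x hx
    rw [if_neg, mul_zero, zero_smul]
    rintro ⟨c, rfl⟩
    exact hx ⟨c, rfl⟩
  · convert h1 using 1
    funext m
    simp only [Function.comp_apply, if_pos (dvd_mul_right p m), Nat.mul_div_cancel_left m hp.pos,
      smul_eq_mul]
    ring

/-- Discharge of `qExpansion_coeff_heckeT` (**Diamond–Shurman Prop. 5.2.2(a)** for `Γ₀(N)`, i.e.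
(5.4) with trivial character; Prop. 5.3.1 for `n = p`): for `p` prime and `f ∈ S_k(Γ₀(N))`,
`a_n(T_p f) = a_{pn}(f) + 𝟙_N(p) p^{k-1} a_{n/p}(f)`. Proof as in the source: by
`coe_heckeT_gamma0_eq_sum` (Prop. 5.2.1), `T_p f = ∑_{j mod p} f ∣ (1 j; 0 p) + 𝟙_N(p) f ∣ diag(p,1)`;
the first sum is `∑_n a_{pn} qⁿ` by orthogonality of `j ↦ ζ_p^{mj}` (`hasSum_sum_slash_tpB`), the
last term is `p^{k-1} ∑_n a_n q^{pn}` (`hasSum_slash_tpD`); conclude by uniqueness of `q`-expansion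
coefficients (`ModularFormClass.qExpansion_coeff_unique`). [cite: DiamondShurman2005, Prop. 5.2.2(a) and Prop. 5.3.1] -/
theorem qExpansion_coeff_heckeT_holds : qExpansion_coeff_heckeT N k := by
  intro f p _ hp n
  set c : ℕ → ℂ := fun n ↦ (qExpansion 1 ⇑f).coeff (p * n) +
        (if p ∣ N then 0
         else (p : ℂ) ^ (k - 1) * (if p ∣ n then (qExpansion 1 ⇑f).coeff (n / p) else 0)) with hc
  have hsum : ∀ τ : ℍ, HasSum (fun m ↦ c m • Periodic.qParam 1 (τ : ℂ) ^ m)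
      (heckeT (Gamma0 N) k p f τ) := by
    intro τ
    rw [coe_heckeT_gamma0_eq_sum N k p hp f, Pi.add_apply]
    simp only [hc, add_smul]
    refine HasSum.add (hasSum_sum_slash_tpB N k p hp f τ) ?_
    by_cases hpN : p ∣ N
    · simp only [if_pos hpN, zero_smul, Pi.zero_apply]
      exact hasSum_zero
    · simp only [if_neg hpN]
      exact hasSum_slash_tpD N k p hp f τ
  rw [← ModularFormClass.qExpansion_coeff_unique one_pos (one_mem_strictPeriods_gamma0 N)
    (f := heckeT (Gamma0 N) k p f) hsum n, hc]

end Assembly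

end Literature.NumberTheory.EllipticCurves.ModularForms

end
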